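import Mathlib
import HarnessLib
import Summits.Ventures.LatticeQCDFlow.Scoring.GaussianNoncentralCochranReduction
import Summits.Ventures.LatticeQCDFlow.Scoring.GaussianCochranIndependence

/-!
# WITH DIFFERENT CENTRES THE POOLED MEAN AND THE HOMOGENEITY STATISTIC ARE STILL INDEPENDENT:
# `N^{⊗ι}({⟨u, z+θ⟩ ∈ A} ∩ {‖z+θ‖² − ⟨u, z+θ⟩² ∈ B}) = N(⟨u,θ⟩, 1)(A) · N^{⊗ι}{(z_{r₁}+κ)² + Σ_{r≠r₀,r₁} z_r² ∈ B}`

HONEST FRAMING: exact (Metropolis-corrected) sampling algorithms for lattice gauge theory;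
figures of merit are autocorrelation/cost numbers at stated couplings and volumes; no
continuum-physics claim.

Venture `LatticeQCDFlow` (cell pub-lqcd), topic `Scoring`; FANOUT row 4 (`s0-u1-b`, GEN-35).
NEW WORK of the cell (classical), no definition, nothing cited as a fact (the independence of a
Gaussian vector's component along `u` and its residual — Fisher/Cochran, non-central case — NAMED ONLY).

WHY (row 4).  `Scoring/GaussianCochranIndependence` factorises the joint law of the studentised
pooled mean and the homogeneity statistic when all codes have the SAME centre.  Under the local
alternatives of `Scoring/KArmHomogeneityLocalPower` (centres `a + h_r/√k`) the Gaussian picture is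
shifted by `θ` (`θ_i = h_i/σ_i` in standardised coordinates): the pooled statistic becomes
`⟨u, z + θ⟩ ∼ N(⟨u, θ⟩, 1)` — it carries the WEIGHTED-MEAN drift `⟨u,θ⟩ = h̄_w·√W` — and the
homogeneity statistic becomes the shifted Cochran functional `‖z+θ‖² − ⟨u, z+θ⟩²`, the shifted
ball with `κ² = ‖θ‖² − ⟨u,θ⟩²` of `Scoring/GaussianNoncentralCochranReduction`.  This file shows the
two REMAIN INDEPENDENT with exactly these marginals: in the adapted orthonormal basis of that file
(`b r₀ = u`, `θ − ⟨u,θ⟩u = κ • b r₁`) they are functions of the disjoint coordinate sets `{r₀}` and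
`ι ∖ {r₀}` of a standard Gaussian vector.  Consequence drawn downstream
(`Scoring/KArmPooledUnderDrift`): selecting on the homogeneity test cannot remove — or even
change — the drift `h̄_w` inherited by the pooled estimate; a drift COMMON to all codes is invisible
to the test and fully present in the pooled interval.

## Content

* **`pi_gaussianReal_evalShift_inter_shiftedBall_eq_mul`** (§1) — `r₀ ≠ r₁`, Borel `A, B`:
  `N^{⊗ι}({w | w_{r₀} + τ ∈ A} ∩ {w | (w_{r₁} + κ)² + Σ_{r≠r₀,r₁} w_r² ∈ B})
     = N(τ,1)(A) · N^{⊗ι}{w | (w_{r₁} + κ)² + Σ_{r≠r₀,r₁} w_r² ∈ B}`.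
* **`pi_gaussianReal_linearShift_inter_noncentralCochran_eq_mul`** (§2) — `Σ_i u_i² = 1`, any `θ`:
  `N^{⊗ι}({z | Σ_i u_i (z_i+θ_i) ∈ A} ∩ {z | Σ_i (z_i+θ_i)² − (Σ_i u_i (z_i+θ_i))² ∈ B})
     = N(Σ_i u_i θ_i, 1)(A) · N^{⊗ι}{z | (z_{r₁} + κ)² + Σ_{r≠r₀,r₁} z_r² ∈ B}`,
  `κ = √(Σ_i θ_i² − (Σ_i u_i θ_i)²)`.
* **`pi_gaussianReal_pooled_inter_homogeneity_centres_eq_mul`** (§3) — `k`-arm vocabulary with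
  DIFFERENT centres `μ_i` (`σ_i > 0`, `W = Σ_i σ_i⁻²`, `x_i = μ_i + σ_i z_i`, `m̂ = (Σ_i x_i/σ_i²)/W`,
  `μ̄_w = (Σ_i μ_i/σ_i²)/W`):
  `N^{⊗ι}({z | m̂(z)·√W ∈ A} ∩ {z | Σ_i (x_i − m̂)²/σ_i² ∈ B})
     = N(μ̄_w·√W, 1)(A) · N^{⊗ι}{z | (z_{r₁} + κ)² + Σ_{r≠r₀,r₁} z_r² ∈ B}`, `κ² = Σ_i (μ_i − μ̄_w)²/σ_i²`.

[ours] throughout.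
-/

open MeasureTheory ProbabilityTheory Filter Topology Finset

namespace Summit.Ventures.LatticeQCDFlow.Scoring

open Set WithLp
open scoped RealInnerProductSpace

/-! ## §1 A shifted coordinate and the shifted ball on the other coordinates are independent -/

section Coordinates

variable {ι : Type*} [Fintype ι] [DecidableEq ι]

/-- Under `N(0,1)^{⊗ι}`, for `r₀ ≠ r₁`, the variables `w_{r₀} + τ` and
`(w_{r₁} + κ)² + Σ_{r≠r₀,r₁} w_r²` are independent. [ours] -/
theorem indepFun_evalShift_shiftedBall_pi_gaussianReal {r₀ r₁ : ι} (h01 : r₀ ≠ r₁) (τ κ : ℝ) :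
    IndepFun (fun w : ι → ℝ => w r₀ + τ)
      (fun w : ι → ℝ => (w r₁ + κ) ^ 2 + ∑ r ∈ (univ.erase r₀).erase r₁, w r ^ 2)
      (Measure.pi fun _ : ι => gaussianReal 0 1) := by
  have hind : iIndepFun (fun i (z : ι → ℝ) => z i) (Measure.pi fun _ : ι => gaussianReal 0 1) :=
    iIndepFun_pi (X := fun (_ : ι) (x : ℝ) => x) fun _ => measurable_id.aemeasurable
  have hdisj : Disjoint ({r₀} : Finset ι) (univ.erase r₀) := by
    rw [Finset.disjoint_singleton_left]
    exact Finset.notMem_erase r₀ univ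
  have hr1 : r₁ ∈ univ.erase r₀ := Finset.mem_erase.2 ⟨h01.symm, Finset.mem_univ _⟩
  have h2 := hind.indepFun_finset ({r₀} : Finset ι) (univ.erase r₀) hdisj
    fun i => measurable_pi_apply i
  have h3 := h2.comp
    (φ := fun x : ↥({r₀} : Finset ι) → ℝ => x ⟨r₀, Finset.mem_singleton_self r₀⟩ + τ)
    (ψ := fun y : ↥(univ.erase r₀) → ℝ => (y ⟨r₁, hr1⟩ + κ) ^ 2 + (∑ i, y i ^ 2 - y ⟨r₁, hr1⟩ ^ 2))
    ((measurable_pi_apply (X := fun _ : ↥({r₀} : Finset ι) => ℝ)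
      (⟨r₀, Finset.mem_singleton_self r₀⟩ : ↥({r₀} : Finset ι))).add_const τ)
    (by fun_prop)
  have hψ : ((fun y : ↥(univ.erase r₀) → ℝ => (y ⟨r₁, hr1⟩ + κ) ^ 2 + (∑ i, y i ^ 2 - y ⟨r₁, hr1⟩ ^ 2)) ∘
      fun (z : ι → ℝ) (i : ↥(univ.erase r₀)) => z i)
      = fun w : ι → ℝ => (w r₁ + κ) ^ 2 + ∑ r ∈ (univ.erase r₀).erase r₁, w r ^ 2 := by
    funext w
    simp only [Function.comp_apply]
    rw [Finset.sum_coe_sort (univ.erase r₀) (fun r => w r ^ 2), Finset.sum_erase_eq_sub hr1]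
  rw [hψ] at h3
  exact h3

/-- **A SHIFTED COORDINATE AND THE SHIFTED BALL ON THE OTHERS FACTORISE**: `r₀ ≠ r₁`, Borel `A, B`:
`N^{⊗ι}({w | w_{r₀} + τ ∈ A} ∩ {w | (w_{r₁} + κ)² + Σ_{r≠r₀,r₁} w_r² ∈ B})
  = N(τ,1)(A) · N^{⊗ι}{w | (w_{r₁} + κ)² + Σ_{r≠r₀,r₁} w_r² ∈ B}`. [ours] -/
theorem pi_gaussianReal_evalShift_inter_shiftedBall_eq_mul {r₀ r₁ : ι} (h01 : r₀ ≠ r₁) (τ κ : ℝ)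
    {A B : Set ℝ} (hA : MeasurableSet A) (hB : MeasurableSet B) :
    (Measure.pi fun _ : ι => gaussianReal 0 1)
        ({w : ι → ℝ | w r₀ + τ ∈ A}
          ∩ {w : ι → ℝ | (w r₁ + κ) ^ 2 + ∑ r ∈ (univ.erase r₀).erase r₁, w r ^ 2 ∈ B})
      = gaussianReal τ 1 A
        * (Measure.pi fun _ : ι => gaussianReal 0 1)
          {w : ι → ℝ | (w r₁ + κ) ^ 2 + ∑ r ∈ (univ.erase r₀).erase r₁, w r ^ 2 ∈ B} := by
  have h := (indepFun_evalShift_shiftedBall_pi_gaussianReal (ι := ι) h01 τ κ).measure_inter_preimage_eq_mul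
    A B hA hB
  have hmarg : (Measure.pi fun _ : ι => gaussianReal 0 1) ((fun w : ι → ℝ => w r₀ + τ) ⁻¹' A)
      = gaussianReal τ 1 A := by
    have e : (fun w : ι → ℝ => w r₀ + τ) ⁻¹' A
        = (fun w : ι → ℝ => w r₀) ⁻¹' ((fun x : ℝ => x + τ) ⁻¹' A) := rfl
    rw [e, ← Measure.map_apply (measurable_pi_apply r₀) ((measurable_add_const τ) hA),
      (measurePreserving_eval (fun _ : ι => gaussianReal 0 1) r₀).map_eq,
      ← Measure.map_apply (measurable_add_const τ) hA, gaussianReal_map_add_const, zero_add]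
  rw [hmarg] at h
  exact h

end Coordinates

/-! ## §2 The shifted linear statistic and the non-central Cochran functional are independent -/

section Cochran

variable {ι : Type*} [Fintype ι] [DecidableEq ι]

/-- **THE SHIFTED LINEAR STATISTIC AND THE NON-CENTRAL COCHRAN FUNCTIONAL FACTORISE**: for every
`u : ι → ℝ` with `Σ_i u_i² = 1`, every shift `θ`, all `r₀ ≠ r₁` and Borel `A, B`,
`N^{⊗ι}({z | Σ_i u_i (z_i+θ_i) ∈ A} ∩ {z | Σ_i (z_i+θ_i)² − (Σ_i u_i (z_i+θ_i))² ∈ B})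
  = N(Σ_i u_i θ_i, 1)(A) · N^{⊗ι}{z | (z_{r₁} + κ)² + Σ_{r≠r₀,r₁} z_r² ∈ B}`,
`κ = √(Σ_i θ_i² − (Σ_i u_i θ_i)²)` (textbook: `N(⟨u,θ⟩, 1) ⊗ χ²_{k−1}(κ²)`). [ours] -/
theorem pi_gaussianReal_linearShift_inter_noncentralCochran_eq_mul {r₀ r₁ : ι} (h01 : r₀ ≠ r₁)
    (u θ : ι → ℝ) (hu : ∑ i, u i ^ 2 = 1) {A B : Set ℝ} (hA : MeasurableSet A)
    (hB : MeasurableSet B) :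
    (Measure.pi fun _ : ι => gaussianReal 0 1)
        ({z : ι → ℝ | ∑ i, u i * (z i + θ i) ∈ A}
          ∩ {z : ι → ℝ | ∑ i, (z i + θ i) ^ 2 - (∑ i, u i * (z i + θ i)) ^ 2 ∈ B})
      = gaussianReal (∑ i, u i * θ i) 1 A
        * (Measure.pi fun _ : ι => gaussianReal 0 1)
          {z : ι → ℝ | (z r₁ + Real.sqrt (∑ i, θ i ^ 2 - (∑ i, u i * θ i) ^ 2)) ^ 2
            + ∑ r ∈ (univ.erase r₀).erase r₁, z r ^ 2 ∈ B} := by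
  set uE : EuclideanSpace ℝ ι := toLp 2 u with huE
  set θE : EuclideanSpace ℝ ι := toLp 2 θ with hθE
  have hnu : ‖uE‖ = 1 := by
    have h2 : ‖uE‖ ^ 2 = 1 := by
      rw [EuclideanSpace.real_norm_sq_eq]
      simpa [huE] using hu
    have h0 : 0 ≤ ‖uE‖ := norm_nonneg _
    nlinarith [h2, h0]
  obtain ⟨b, hb0, hb1⟩ := exists_orthonormalBasis_unit_shift h01 hnu θE
  set κ := ‖θE - ⟪uE, θE⟫ • uE‖ with hκdef
  have hκ : κ = Real.sqrt (∑ i, θ i ^ 2 - (∑ i, u i * θ i) ^ 2) := by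
    have h2 : κ ^ 2 = ∑ i, θ i ^ 2 - (∑ i, u i * θ i) ^ 2 := by
      have hpy : ‖θE - ⟪uE, θE⟫ • uE‖ ^ 2 = ‖θE‖ ^ 2 - ⟪uE, θE⟫ ^ 2 := by
        rw [norm_sub_sq_real, inner_smul_right, real_inner_comm uE θE, norm_smul, hnu, mul_one,
          Real.norm_eq_abs, sq_abs]
        ring
      rw [hκdef, hpy, EuclideanSpace.real_norm_sq_eq, hθE, huE, real_inner_comm,
        inner_toLp_toLp_eq_sum]
    rw [← h2, Real.sqrt_sq (norm_nonneg _)]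
  have hτ : ⟪uE, θE⟫ = ∑ i, u i * θ i := by
    rw [huE, hθE, real_inner_comm, inner_toLp_toLp_eq_sum]
  rw [← hκ, ← hτ]
  set O := b.repr with hO
  have hmp := measurePreserving_euclidean_isometry_pi (ι := ι) O
  have hTm : MeasurableSet ({w : ι → ℝ | w r₀ + ⟪uE, θE⟫ ∈ A}
      ∩ {w : ι → ℝ | (w r₁ + κ) ^ 2 + ∑ r ∈ (univ.erase r₀).erase r₁, w r ^ 2 ∈ B}) :=
    (((measurable_pi_apply r₀).add_const _) hA).inter ((by fun_prop : Measurable fun w : ι → ℝ =>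
      (w r₁ + κ) ^ 2 + ∑ r ∈ (univ.erase r₀).erase r₁, w r ^ 2) hB)
  have hco : ∀ (z : ι → ℝ) r, (ofLp (O (toLp 2 z)) : ι → ℝ) r = ⟪b r, (toLp 2 z : EuclideanSpace ℝ ι)⟫ :=
    fun z r => by rw [hO]; exact b.repr_apply_apply _ r
  have hlin : ∀ z : ι → ℝ, ∑ i, u i * (z i + θ i)
      = ⟪b r₀, (toLp 2 z : EuclideanSpace ℝ ι)⟫ + ⟪uE, θE⟫ := fun z => by
    have h1 : ∑ i, u i * (z i + θ i) = ⟪uE, (toLp 2 z : EuclideanSpace ℝ ι) + θE⟫ := by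
      have e : (toLp 2 z : EuclideanSpace ℝ ι) + θE = toLp 2 (z + θ) := rfl
      rw [e, huE, real_inner_comm, inner_toLp_toLp_eq_sum]
      rfl
    rw [h1, inner_add_right, hb0]
  have hpre : ({z : ι → ℝ | ∑ i, u i * (z i + θ i) ∈ A}
        ∩ {z : ι → ℝ | ∑ i, (z i + θ i) ^ 2 - (∑ i, u i * (z i + θ i)) ^ 2 ∈ B})
      = (fun z : ι → ℝ => ofLp (O (toLp 2 z))) ⁻¹'
          ({w : ι → ℝ | w r₀ + ⟪uE, θE⟫ ∈ A}
            ∩ {w : ι → ℝ | (w r₁ + κ) ^ 2 + ∑ r ∈ (univ.erase r₀).erase r₁, w r ^ 2 ∈ B}) := by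
    ext z
    simp only [Set.mem_inter_iff, Set.mem_setOf_eq, Set.mem_preimage, hco]
    rw [sum_sq_add_sub_sq_eq_norm, ← huE, ← hθE,
      norm_sq_sub_inner_sq_shift_eq h01 b hb0 hb1 (toLp 2 z), hlin z]
  rw [hpre, ← Measure.map_apply hmp.measurable hTm, hmp.map_eq]
  exact pi_gaussianReal_evalShift_inter_shiftedBall_eq_mul h01 _ κ hA hB

end Cochran

/-! ## §3 In the `k`-arm vocabulary with different centres -/

section Pooled

variable {ι : Type*} [Fintype ι] [DecidableEq ι]

/-- **THE STUDENTISED POOLED MEAN AND THE HOMOGENEITY STATISTIC WITH DIFFERENT CENTRES FACTORISE**: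
`σ_i > 0`, arbitrary centres `μ_i`, `r₀ ≠ r₁`, Borel `A, B`; with `x_i = μ_i + σ_i z_i`,
`W = Σ_i σ_i⁻²`, `m̂ = (Σ_i x_i/σ_i²)/W`, `μ̄_w = (Σ_i μ_i/σ_i²)/W`:
`N^{⊗ι}({z | m̂(z)·√W ∈ A} ∩ {z | Σ_i (x_i − m̂(z))²/σ_i² ∈ B})
  = N(μ̄_w·√W, 1)(A) · N^{⊗ι}{z | (z_{r₁} + κ)² + Σ_{r≠r₀,r₁} z_r² ∈ B}`, `κ = √(Σ_i (μ_i − μ̄_w)²/σ_i²)`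
— the pooled mean carries the weighted-mean centre, the homogeneity statistic the dispersion of the
centres, and the two are independent (textbook: `N ⊗` non-central `χ²_{k−1}`). [ours] -/
theorem pi_gaussianReal_pooled_inter_homogeneity_centres_eq_mul {r₀ r₁ : ι} (h01 : r₀ ≠ r₁)
    (μ σ : ι → ℝ) (hσ : ∀ i, 0 < σ i) {A B : Set ℝ} (hA : MeasurableSet A) (hB : MeasurableSet B) :
    (Measure.pi fun _ : ι => gaussianReal 0 1)
        ({z : ι → ℝ | (∑ j, (μ j + σ j * z j) / σ j ^ 2) / (∑ j, (σ j ^ 2)⁻¹)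
            * Real.sqrt (∑ j, (σ j ^ 2)⁻¹) ∈ A}
          ∩ {z : ι → ℝ | ∑ i, ((μ i + σ i * z i) - (∑ j, (μ j + σ j * z j) / σ j ^ 2)
            / (∑ j, (σ j ^ 2)⁻¹)) ^ 2 / σ i ^ 2 ∈ B})
      = gaussianReal ((∑ j, μ j / σ j ^ 2) / (∑ j, (σ j ^ 2)⁻¹) * Real.sqrt (∑ j, (σ j ^ 2)⁻¹)) 1 A
        * (Measure.pi fun _ : ι => gaussianReal 0 1)
          {z : ι → ℝ | (z r₁ + Real.sqrt (∑ i, (μ i - (∑ j, μ j / σ j ^ 2) / (∑ j, (σ j ^ 2)⁻¹)) ^ 2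
            / σ i ^ 2)) ^ 2 + ∑ r ∈ (univ.erase r₀).erase r₁, z r ^ 2 ∈ B} := by
  have hne : Nonempty ι := ⟨r₀⟩
  set W := ∑ i, (σ i ^ 2)⁻¹ with hWdef
  have hW : 0 < W := Finset.sum_pos (fun i _ => by have := hσ i; positivity) Finset.univ_nonempty
  have hsqW : Real.sqrt W ≠ 0 := (Real.sqrt_pos.2 hW).ne'
  set u : ι → ℝ := fun i => (σ i)⁻¹ / Real.sqrt W with hu
  set θ : ι → ℝ := fun i => μ i / σ i with hθ
  have hu1 : ∑ i, u i ^ 2 = 1 := by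
    simp only [hu, div_pow, inv_pow, Real.sq_sqrt hW.le]
    rw [← Finset.sum_div, ← hWdef, div_self hW.ne']
  -- the pooled mean in standardised coordinates
  have hlin : ∀ z : ι → ℝ, ∑ i, u i * (z i + θ i)
      = (∑ j, (μ j + σ j * z j) / σ j ^ 2) / W * Real.sqrt W := fun z => by
    have h1 : ∑ i, u i * (z i + θ i) = (∑ j, (μ j + σ j * z j) / σ j ^ 2) / Real.sqrt W := by
      rw [Finset.sum_div]
      refine Finset.sum_congr rfl fun i _ => ?_
      simp only [hu, hθ]
      field_simp [(hσ i).ne']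
      ring
    rw [h1, div_mul_eq_mul_div, div_eq_div_iff hsqW hW.ne', mul_assoc, Real.mul_self_sqrt hW.le]
  have hτ : ∑ i, u i * θ i = (∑ j, μ j / σ j ^ 2) / W * Real.sqrt W := by
    have h1 : ∑ i, u i * θ i = (∑ j, μ j / σ j ^ 2) / Real.sqrt W := by
      rw [Finset.sum_div]
      refine Finset.sum_congr rfl fun i _ => ?_
      simp only [hu, hθ]
      field_simp [(hσ i).ne']
    rw [h1, div_mul_eq_mul_div, div_eq_div_iff hsqW hW.ne', mul_assoc, Real.mul_self_sqrt hW.le]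
  have hset1 : {z : ι → ℝ | (∑ j, (μ j + σ j * z j) / σ j ^ 2) / (∑ j, (σ j ^ 2)⁻¹)
        * Real.sqrt (∑ j, (σ j ^ 2)⁻¹) ∈ A} = {z : ι → ℝ | ∑ i, u i * (z i + θ i) ∈ A} := by
    ext z
    simp only [Set.mem_setOf_eq, hlin z, ← hWdef]
  have hset2 : {z : ι → ℝ | ∑ i, ((μ i + σ i * z i) - (∑ j, (μ j + σ j * z j) / σ j ^ 2)
          / (∑ j, (σ j ^ 2)⁻¹)) ^ 2 / σ i ^ 2 ∈ B}
        = {z : ι → ℝ | ∑ i, (z i + θ i) ^ 2 - (∑ i, u i * (z i + θ i)) ^ 2 ∈ B} := by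
    ext z
    simp only [Set.mem_setOf_eq]
    rw [homogeneity_statistic_centres_eq μ σ z (fun i => (hσ i).ne') hW.ne']
    have hS : (∑ i, u i * (z i + θ i)) ^ 2 = (∑ i, (z i + μ i / σ i) / σ i) ^ 2 / W := by
      have : ∑ i, u i * (z i + θ i) = (∑ i, (z i + μ i / σ i) / σ i) / Real.sqrt W := by
        rw [Finset.sum_div]
        refine Finset.sum_congr rfl fun i _ => ?_
        simp only [hu, hθ]
        field_simp
      rw [this, div_pow, Real.sq_sqrt hW.le]
    rw [hS]
  have hκ : ∑ i, θ i ^ 2 - (∑ i, u i * θ i) ^ 2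
      = ∑ i, (μ i - (∑ j, μ j / σ j ^ 2) / (∑ j, (σ j ^ 2)⁻¹)) ^ 2 / σ i ^ 2 := by
    simp only [hu, hθ, hWdef]
    exact noncentrality_sq_eq μ σ hσ
  rw [hset1, hset2, pi_gaussianReal_linearShift_inter_noncentralCochran_eq_mul h01 u θ hu1 hA hB,
    hκ, hτ]

end Pooled

end Summit.Ventures.LatticeQCDFlow.Scoring
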